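import Literature.Analysis.FluidPDE.KNSSLiouville
import Literature.Analysis.FluidPDE.CurlFreeLiouville
import Literature.Analysis.FluidPDE.KNSSAxisymmetricNoSwirl
import HarnessLib

/-!
# The end of the proof of KNSS's Theorem 5.2: from `ω = 0` to `u(x, t) = (0, 0, b₃(t))`

Analysis/FluidPDE support file (all results proved) on the decomposition path of the named fact
`Literature.Analysis.FluidPDE.KNSS2009_liouville_axisymmetric_no_swirl` (Koch–Nadirashvili–
Seregin–Šverák, *Liouville theorems for the Navier–Stokes equations and applications*, Acta
Math. 203 (2009) = arXiv:0709.3599, **Theorem 5.2**: a bounded weak solution in `ℝ³ × (−∞, 0)`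
which is axisymmetric with no swirl is `u(x, t) = (0, 0, b₃(t))`). The printed proof (p. 10)
ends: "hence `ω_θ` vanishes identically. For axi-symmetric vector fields with no swirl this
means that `ω = 0` and the proof is finished by again applying the Liouville theorem to the
system `curl u = 0`, `div u = 0`." The Liouville step is `CurlFreeLiouville`; this file proves
the packaging of the conclusion, in the representation furnished by the regularity theory of §4
(`KNSS2009_regularity_boundedWeak_ancient`, `KNSSRegularity`: `u = U + b(t)` a.e. with smooth
bounded divergence-free slices `U(t, ·)`, `U` jointly measurable, `b` bounded measurable):

* `rotZ_pi_eq_of_ae_eq_const`: a constant a.e. equal to a field which is a.e. equivariant under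
  the half-turn `R_π` is fixed by `R_π`;
* `KNSS2009_thm52_of_curl_eq_zero` (**end of the proof of Theorem 5.2**): if every slice
  `U(t, ·)`, `t < 0`, is irrotational, then `u(t, ·) = b₃(t) e_z` a.e. for a.e. `t < 0` with `b₃`
  bounded measurable — each `U(t, ·)` is constant by the Liouville theorem for `curl = 0`,
  `div = 0` (`eq_of_curl_eq_zero_of_isDivFree_of_bounded`, `CurlFreeLiouville`), the constant
  `c(t) = U(t, 0) + b(t)` is measurable and bounded, and the `L^∞` axisymmetry of `u` under the
  half-turn gives `R_π c(t) = c(t)`, i.e. `c(t) ∥ e_z` (`eq_smul_eZ_of_rotZ_pi_eq`,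
  `KNSSAxisymmetricNoSwirl`). Only the half-turn is used, and only for a.e. `t`; the conclusion
  is literally that of `KNSS2009_liouville_axisymmetric_no_swirl`. The primed version
  `KNSS2009_thm52_of_curl_eq_zero'` takes the hypotheses in the clause shapes of the §4 fact and
  of Theorem 5.2 (every angle, `C^∞` slices, all derivative bounds).

What is *not* here: the maximum-principle argument showing `ω = 0` (Lemma 2.1 on `ℝ⁵` applied
to `ω_θ / r`, KNSS p. 10), which is the remaining input between the §4 representation and the
hypothesis `curl (U t) = 0` of `KNSS2009_thm52_of_curl_eq_zero`.

## References

* G. Koch, N. Nadirashvili, G. Seregin, V. Šverák, *Liouville theorems for the Navier–Stokes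
  equations and applications*, Acta Math. 203 (2009) 83–105 = arXiv:0709.3599: Theorem 5.2 and
  its proof, last two sentences (p. 10); proof of Theorem 5.1, last sentence (p. 9: "`curl u = 0`
  … together with `div u = 0` and the boundedness of `u`, implies (by the classical Liouville
  theorem for harmonic functions) that `u` is constant in `x` for each `t`"). [KochNadirashviliSereginSverak2009]
-/

noncomputable section

open MeasureTheory Set Function Filter TopologicalSpace InnerProductSpace
open scoped RealInnerProductSpace Laplacian ContDiff

namespace Literature.Analysis.FluidPDE

/-! ### The end of the proof of Theorem 5.2: from `ω = 0` to `u(x, t) = (0, 0, b₃(t))` -/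

/-- A constant `c` a.e. equal to its rotated copy is fixed: if `u =ᵐ c` and
`u ∘ R_π =ᵐ R_π ∘ u` then `R_π c = c` (pull back along the measure-preserving `R_π`). [folklore] -/
theorem rotZ_pi_eq_of_ae_eq_const {v : EuclideanSpace ℝ (Fin 3) → EuclideanSpace ℝ (Fin 3)}
    {c : EuclideanSpace ℝ (Fin 3)} (hv : v =ᵐ[volume] fun _ => c)
    (hrot : (fun x => v (rotZ Real.pi x)) =ᵐ[volume] fun x => rotZ Real.pi (v x)) :
    rotZ Real.pi c = c := by
  have h1 : ∀ᵐ x ∂(volume : Measure (EuclideanSpace ℝ (Fin 3))), v (rotZ Real.pi x) = c :=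
    (measurePreserving_rotZ Real.pi).quasiMeasurePreserving.ae hv
  have h2 : ∀ᵐ x ∂(volume : Measure (EuclideanSpace ℝ (Fin 3))), rotZ Real.pi c = c := by
    filter_upwards [hv, hrot, h1] with x hx hx' hx1
    rw [← hx, ← hx', hx1, hx]
  exact h2.exists.choose_spec

/-- **End of the proof of KNSS 2009, Theorem 5.2** (arXiv:0709.3599 p. 10: "hence `ω_θ` vanishes
identically. For axi-symmetric vector fields with no swirl this means that `ω = 0` and the proof
is finished by again applying the Liouville theorem to the system `curl u = 0`, `div u = 0`";
statement: "`u(x, t) = (0, 0, b₃(t))` for some bounded measurable `b₃`"). Let `u : ℝ → ℝ³ → ℝ³`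
agree for a.e. `t < 0`, a.e. in `x`, with `U(t, ·) + b(t)`, where `b` is measurable and
bounded, `(t, x) ↦ U(t, x)` is measurable, and every slice `U(t, ·)`, `t < 0`, is `C²`, bounded
uniformly in `t`, divergence free and **irrotational** (the output of the regularity theory of §4,
`KNSS2009_regularity_boundedWeak_ancient`, once the maximum-principle argument has killed the
vorticity); and let `u` be axisymmetric under the half-turn in the `L^∞` sense
(`u(t, R_π x) = R_π u(t, x)` a.e. in `x`, for a.e. `t < 0`). Then there is a bounded measurable
`b₃ : ℝ → ℝ` with `u(t, ·) = b₃(t) e_z` a.e., for a.e. `t < 0`: each `U(t, ·)` is constant by the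
Liouville theorem for `curl = 0`, `div = 0` (`eq_of_curl_eq_zero_of_isDivFree_of_bounded`,
`CurlFreeLiouville`),
the constant `c(t) = U(t, 0) + b(t)` is measurable and bounded, and `R_π c(t) = c(t)` forces
`c(t) = c₂(t) e_z` (`eq_smul_eZ_of_rotZ_pi_eq`). [cite: KochNadirashviliSereginSverak2009, Thm 5.2 and its proof, last two sentences (arXiv p. 10)] -/
theorem KNSS2009_thm52_of_curl_eq_zero
    {u U : ℝ → EuclideanSpace ℝ (Fin 3) → EuclideanSpace ℝ (Fin 3)} {b : ℝ → EuclideanSpace ℝ (Fin 3)}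
    (hrot : ∀ᵐ t ∂((volume : Measure ℝ).restrict (Iio 0)),
      (fun x => u t (rotZ Real.pi x)) =ᵐ[volume] fun x => rotZ Real.pi (u t x))
    (hbm : Measurable b) (hbC : ∃ C : ℝ, ∀ t, ‖b t‖ ≤ C) (hUm : Measurable (uncurry U))
    (hae : ∀ᵐ t ∂((volume : Measure ℝ).restrict (Iio 0)), u t =ᵐ[volume] fun x => U t x + b t)
    (hU2 : ∀ t < 0, ContDiff ℝ 2 (U t)) (hdiv : ∀ t < 0, VectorCalculus.IsDivFree (U t))
    (hUC : ∃ C : ℝ, ∀ t < 0, ∀ x, ‖U t x‖ ≤ C) (hcurl : ∀ t < 0, ∀ x, curl (U t) x = 0) :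
    ∃ b₃ : ℝ → ℝ, Measurable b₃ ∧ (∃ C : ℝ, ∀ t, |b₃ t| ≤ C) ∧
      ∀ᵐ t ∂((volume : Measure ℝ).restrict (Iio 0)), u t =ᵐ[volume] fun _ => b₃ t • eZ := by
  obtain ⟨Cb, hCb⟩ := hbC
  obtain ⟨CU, hCU⟩ := hUC
  -- the constant of each slice
  set c : ℝ → EuclideanSpace ℝ (Fin 3) := fun t => U t 0 + b t with hc
  have hcm : Measurable c :=
    (hUm.comp (measurable_id.prodMk measurable_const)).add hbm
  have hconst : ∀ t < 0, ∀ x, U t x + b t = c t := fun t ht x => by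
    rw [hc, eq_of_curl_eq_zero_of_isDivFree_of_bounded (hU2 t ht) (hcurl t ht) (hdiv t ht)
      (hCU t ht) x 0]
  -- the coefficient `b₃`
  refine ⟨fun t => if t < 0 then c t 2 else 0, ?_, ⟨CU + Cb, fun t => ?_⟩, ?_⟩
  · exact Measurable.ite measurableSet_Iio
      ((contDiff_piLp_apply (𝕜 := ℝ) (p := 2) (n := 0)
        (i := (2 : Fin 3))).continuous.measurable.comp hcm) measurable_const
  · show |(if t < 0 then c t 2 else 0)| ≤ CU + Cb
    by_cases ht : t < 0
    · rw [if_pos ht]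
      calc |c t 2| ≤ ‖c t‖ := by simpa using PiLp.norm_apply_le (c t) 2
        _ ≤ ‖U t 0‖ + ‖b t‖ := norm_add_le _ _
        _ ≤ CU + Cb := add_le_add (hCU t ht 0) (hCb t)
    · rw [if_neg ht, abs_zero]
      exact add_nonneg ((norm_nonneg _).trans (hCU (-1) (by norm_num) 0))
        ((norm_nonneg _).trans (hCb 0))
  · filter_upwards [hae, hrot, ae_restrict_mem measurableSet_Iio] with t ht hrt htneg
    have htneg : t < 0 := htneg
    have hct : u t =ᵐ[volume] fun _ => c t := by
      filter_upwards [ht] with x hx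
      rw [hx, hconst t htneg x]
    have hfix : rotZ Real.pi (c t) = c t := rotZ_pi_eq_of_ae_eq_const hct hrt
    have haxial : c t = c t 2 • eZ := eq_smul_eZ_of_rotZ_pi_eq hfix
    rw [if_pos htneg, ← haxial]
    exact hct

/-- **End of the proof of Theorem 5.2, in the clause shapes of the §4 fact and of the theorem.**
The same statement with the hypotheses as they come: the `L^∞` axisymmetry for every angle (as
in `KNSS2009_liouville_axisymmetric_no_swirl`; only `θ = π` is used), `C^∞` slices and the
family of derivative bounds (as in `KNSS2009_regularity_boundedWeak_ancient`; only `C²` and the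
order-`0` bound are used). [cite: KochNadirashviliSereginSverak2009, Thm 5.2 and its proof, last two sentences (arXiv p. 10)] -/
theorem KNSS2009_thm52_of_curl_eq_zero'
    {u U : ℝ → EuclideanSpace ℝ (Fin 3) → EuclideanSpace ℝ (Fin 3)} {b : ℝ → EuclideanSpace ℝ (Fin 3)}
    (haxi : ∀ θ : ℝ, ∀ᵐ t ∂((volume : Measure ℝ).restrict (Iio 0)),
      (fun x => u t (rotZ θ x)) =ᵐ[volume] fun x => rotZ θ (u t x))
    (hbm : Measurable b) (hbC : ∃ C : ℝ, ∀ t, ‖b t‖ ≤ C) (hUm : Measurable (uncurry U))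
    (hae : ∀ᵐ t ∂((volume : Measure ℝ).restrict (Iio 0)), u t =ᵐ[volume] fun x => U t x + b t)
    (hsmooth : ∀ t < 0, ContDiff ℝ ∞ (U t)) (hdiv : ∀ t < 0, VectorCalculus.IsDivFree (U t))
    (hbd : ∀ k : ℕ, ∃ C : ℝ, ∀ t < 0, ∀ x, ‖iteratedFDeriv ℝ k (U t) x‖ ≤ C)
    (hcurl : ∀ t < 0, ∀ x, curl (U t) x = 0) :
    ∃ b₃ : ℝ → ℝ, Measurable b₃ ∧ (∃ C : ℝ, ∀ t, |b₃ t| ≤ C) ∧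
      ∀ᵐ t ∂((volume : Measure ℝ).restrict (Iio 0)), u t =ᵐ[volume] fun _ => b₃ t • eZ := by
  obtain ⟨C0, hC0⟩ := hbd 0
  refine KNSS2009_thm52_of_curl_eq_zero (haxi Real.pi) hbm hbC hUm hae
    (fun t ht => (hsmooth t ht).of_le (by norm_cast)) hdiv ⟨C0, fun t ht x => ?_⟩ hcurl
  have h := hC0 t ht x
  rwa [norm_iteratedFDeriv_zero] at h

end Literature.Analysis.FluidPDE

end
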